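import Literature.NumberTheory.EllipticCurves.AlgebraicModularParametrizationWithShift
import HarnessLib

/-!
# Existence of the `ℚ`-structure of the modular Jacobian on the analytic torus — shift-free, every level

Named fact `nonempty_modularJacobianGaloisData` (statement only): for every level `N ≥ 1` and every embedding
`ι : ℚ̄ → ℂ` there are data `ModularJacobianGaloisData N ι` (the interface of
`Literature/NumberTheory/EllipticCurves/AlgebraicModularParametrizationWithShift.lean`: a continuous action of `Γ_ℚ`
on `J₀(N)(ℂ)_tors = (V/Λ)_tors` by `𝕋_ℤ`-linear automorphisms making every modular parametrisation
`jacobiMap D : J₀(N)(ℂ) → W(ℂ)` `Γ_ℚ`-equivariant on torsion).  The sister fact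
`nonempty_algebraicModularParametrizationWithShift` of that file states the same WITH the shift for `9 ∣ N` and
records in its docstring that «the shift-free statement for `9 ∤ N` holds by (1)–(3) and is not separately named» —
it is named here because a consumer appeared: crux C1 `stmt-BirchSwinnertonDyer-22296`
(`MainConjectureTransportAlignedAtTwo`), line `birth`, residual (R1) (bsd-line-att-p1 g10, typing ask T1,
2026-08-28T20:05Z; REF2-PLACEMENT-v40-add3 §A: PRINT / KNOWN).  (For `9 ∣ N` the shift-free data are the first three
fields of the data with shift: `(h N h9 ι).some.toModularJacobianGaloisData`.)  No instance, no notation; nothing here proves BSD.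

## References

* [DarmonDiamondTaylor1995] H. Darmon, F. Diamond, R. Taylor, *Fermat's Last Theorem*, §1.3 Thm. 1.15, §1.5
  (pp. 34–36), §1.7 Def. 1.44 and Lemma 1.46.
* [ShimuraIATAF1971] G. Shimura, *Introduction to the Arithmetic Theory of Automorphic Functions*, §6.7, Prop. 7.7,
  Thm. 7.9, Thm. 7.14.
* [Knapp1992] A. Knapp, *Elliptic Curves*, Thm. 11.71, Thm. 11.74 and Remark.
* [BreuilConradDiamondTaylor2001] modularity of every `E/ℚ` (for the consumer's `φ`).
-/


noncomputable section

namespace Literature.NumberTheory.EllipticCurves.ModularForms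

/-- **Existence of the `ℚ`-structure of `J₀(N)` on the analytic torus, every level** (named fact).  For every
`N ≥ 1` and every embedding `ι : ℚ̄ →+* ℂ` there are data `ModularJacobianGaloisData N ι`.  Provenance, clause by
clause (= clauses (1)–(3) of `nonempty_algebraicModularParametrizationWithShift`, which do not use `9 ∣ N`):
(1) `galAct`: `J₀(N)` is an abelian variety over `ℚ` — the Jacobian of Shimura's canonical `ℚ`-model of `X₀(N)` —
with `J₀(N)(ℂ) = V/Λ = J0 N` (Abel–Jacobi), its torsion points are `ℚ̄`-points and `ι` embeds
`J₀(N)(ℚ̄) ↪ J₀(N)(ℂ)`; `𝕋_ℤ`-linearity because every Hecke correspondence is defined over `ℚ`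
(Shimura Prop. 7.7, the congruence relation Thm. 7.9; DDT §1.5 p. 36); (2) `isOpen_stabilizer`: `J₀(N)[n]` is a
finite étale group scheme over `ℚ`, so its points are defined over a number field; (3) `jacobiMap_galAct`: for
every `W/ℚ` and parametrisation datum `D` at level `N`, `jacobiMap D` is the analytification of the
`ℚ`-homomorphism `J₀(N) → A_f → W` (DDT Def. 1.44, Lemma 1.46; the analytic isogeny `ℂ/Λ_f → W(ℂ)`,
`z ↦ c·z`, IS a `ℚ`-rational isogeny: `IsNewformOf` puts `A_f` and `W` in one `ℚ`-isogeny class, so — non-CM —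
`Hom_{ℚ̄}(A_f, W) = ℤ·ψ₀` with `ψ₀` defined over `ℚ` and every analytic homomorphism is `Γ_ℚ`-stable, while — CM —
the condition that the multiplier `c` be RATIONAL and real singles out the `Γ_ℚ`-stable line `ℚ·ψ₀` inside
`End ⊗ ℚ = K`; REF1 §142(b) n1), hence `Γ_ℚ`-equivariant on `ℚ̄`-points — for the strong Weil
curve and its optimal parametrisation this is Shimura Thm. 7.14 / Knapp Thm. 11.74 directly.  No uniqueness is
claimed.  Not proved here (no `X₀(N)` over `ℚ` in the tree).
[cite: DarmonDiamondTaylor1995, §1.3 Thm. 1.15 (p. 28), §1.5 (p. 34–36), §1.7 Def. 1.44 and Lemma 1.46 (p. 44–45)]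
[cite: ShimuraIATAF1971, §6.7, Prop. 7.7, Thm. 7.9, Thm. 7.14] [cite: Knapp1992, Thm. 11.71, Thm. 11.74 and Remark] -/
def nonempty_modularJacobianGaloisData : Prop :=
  ∀ (N : ℕ) [NeZero N] (ι : AlgebraicClosure ℚ →+* ℂ), Nonempty (ModularJacobianGaloisData N ι)

end Literature.NumberTheory.EllipticCurves.ModularForms

end
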